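import Summits.SmoothPoincare4.SmoothPoincare4.Theorems.DottedCircleRasmussenDcrGapHelperFriendsCarrierVkDiscFlowLinesNeat
import Summits.SmoothPoincare4.SmoothPoincare4.Theorems.DottedCircleRasmussenDcrGapHelperFriendsCarrierVkBandDisc

/-!
# Helper `helper_friendsCarrier_Vk_discBand` (piece 12 of the registered helper `helper_friendsCarrier_Vk`,
stub `stub_friendsCarrier`, line `mk_friends`, skeleton v5) for crux `DcrGap`
(item stmt-SmoothPoincare4-16128, route route-SmoothPoincare4-DottedCircleRasmussen)

**The slice disc meets the collar band exactly in the flow lines from `K₁`.**  Consolidation of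
`helper_friendsCarrier_Vk_discFlowLinesNeat` (near the circle the flow lines of the neat-adapted field
from `K₁ u` are the disc rays at level `1 + s`) and `helper_friendsCarrier_Vk_bandDisc` (the deep disc
misses thin bands) into the statement the collar formulas consume: for the neat-adapted field `V` of a
neat model slice disc `f₁` and any flow `Φ` of `V` there is `ε₁ > 0` with

* `Φ(s, K₁ u) ∈ f₁(𝔻²)` for `0 ≤ s < ε₁`, `s ≤ 2ε` (the flow line runs INTO the disc: the ray radius is
  `≤ 1` because `G_k ∘ f₁` strictly decreases along rays near the circle and equals `1` on it);
* every `f₁ x`, `‖x‖ ≤ 1`, off the poles with `G_k(f₁ x) < 1 + ε₁` is `Φ(G_k(f₁ x) - 1, K₁(x/‖x‖))`.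

Hence `Δ₁ ∩ {1 ≤ G_k < 1 + ε₁} = Φ([0, ε₁) × K₁(S¹))` — the `k ≥ 1` form of the conical normal form.

No definitions, no named facts, no `sorry`.
-/

-- the prescribed namespace `Summit.<P>.<Sub>.…` duplicates `SmoothPoincare4` (P = Sub)
set_option linter.dupNamespace false
set_option linter.style.longLine false

noncomputable section

open scoped Manifold ContDiff Topology
open Set Function Metric Filter
open Literature.Topology.FourManifolds Literature.Topology.FourManifolds.MMSW

namespace Summit.SmoothPoincare4.SmoothPoincare4.Theorems.DcrGap.MkFriends

namespace FriendsCarrierVk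

/-- **Along the rays near the circle `G_k ∘ f₁` is strictly decreasing** (neat zone). [folklore] -/
theorem strictAntiOn_level_ray (k : ℕ) {K₁ : (sphere (0 : EuclideanSpace ℝ (Fin 2)) 1) → EuclideanSpace ℝ (Fin 4)}
    {f₁ : EuclideanSpace ℝ (Fin 2) → EuclideanSpace ℝ (Fin 4)}
    (hK : IsModelKnot k K₁) (hf : IsModelSliceDisc k K₁ f₁)
    (hneat : ∀ t : sphere (0 : EuclideanSpace ℝ (Fin 2)) 1,
      deriv (fun ρ : ℝ => levelFun k (f₁ (ρ • (t : EuclideanSpace ℝ (Fin 2))))) 1 < 0) :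
    ∃ δ₂ : ℝ, 0 < δ₂ ∧ δ₂ ≤ 1 / 2 ∧ (∀ x : EuclideanSpace ℝ (Fin 2), |‖x‖ - 1| < δ₂ → ∀ j, (1 : ℝ) / 2 < holeTerm k j (f₁ x)) ∧
      ∀ u : sphere (0 : EuclideanSpace ℝ (Fin 2)) 1,
        StrictAntiOn (fun ρ : ℝ => levelFun k (f₁ (ρ • (u : EuclideanSpace ℝ (Fin 2))))) (Ioo (1 - δ₂) (1 + δ₂)) := by
  have hfs : ContDiff ℝ ∞ f₁ := contMDiff_iff_contDiff.1 hf.1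
  obtain ⟨δ₂, hδ₂, hδ₂h, hzone⟩ := exists_neatZone k hK hf hneat
  refine ⟨δ₂, hδ₂, hδ₂h, fun x hx => (hzone x hx).1, fun u => ?_⟩
  set Gf : EuclideanSpace ℝ (Fin 2) → ℝ := fun y => levelFun k (f₁ y) with hGf
  have hray : ∀ r : ℝ, r ∈ Ioo (1 - δ₂) (1 + δ₂) →
      |‖r • (u : EuclideanSpace ℝ (Fin 2))‖ - 1| < δ₂ ∧ ‖r • (u : EuclideanSpace ℝ (Fin 2))‖⁻¹ • (r • (u : EuclideanSpace ℝ (Fin 2))) = u := by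
    intro r hr
    have hr0 : 0 < r := by linarith [hr.1]
    have hn : ‖r • (u : EuclideanSpace ℝ (Fin 2))‖ = r := by
      rw [norm_smul, norm_eq_of_mem_sphere, mul_one, Real.norm_eq_abs, abs_of_pos hr0]
    refine ⟨by rw [hn, abs_lt]; exact ⟨by linarith [hr.1], by linarith [hr.2]⟩, ?_⟩
    rw [hn, smul_smul, inv_mul_cancel₀ hr0.ne', one_smul]
  have hd : ∀ r ∈ Ioo (1 - δ₂) (1 + δ₂), HasDerivAt (fun ρ : ℝ => Gf (ρ • (u : EuclideanSpace ℝ (Fin 2))))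
      (fderiv ℝ Gf (r • (u : EuclideanSpace ℝ (Fin 2))) (u : EuclideanSpace ℝ (Fin 2))) r := by
    intro r hr
    have hGfat : ContDiffAt ℝ ∞ Gf (r • (u : EuclideanSpace ℝ (Fin 2))) :=
      (contDiffAt_levelFun fun j => (lt_trans (by norm_num) ((hzone _ (hray r hr).1).1 j)).ne').comp _ hfs.contDiffAt
    have hline : HasDerivAt (fun ρ : ℝ => ρ • (u : EuclideanSpace ℝ (Fin 2))) (u : EuclideanSpace ℝ (Fin 2)) r := by
      simpa using (hasDerivAt_id r).smul_const (u : EuclideanSpace ℝ (Fin 2))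
    exact (hGfat.differentiableAt (by simp)).hasFDerivAt.comp_hasDerivAt_of_eq r hline rfl
  refine strictAntiOn_of_deriv_neg (convex_Ioo _ _) (fun r hr => (hd r hr).continuousAt.continuousWithinAt) fun r hr => ?_
  rw [interior_Ioo] at hr
  rw [(hd r hr).deriv]
  have h := (hzone _ (hray r hr).1).2
  rwa [(hray r hr).2] at h

set_option maxHeartbeats 400000 in
/-- **The slice disc meets the collar band exactly in the flow lines from `K₁`.** [folklore] -/
theorem discBand (k : ℕ) {K₁ : (sphere (0 : EuclideanSpace ℝ (Fin 2)) 1) → EuclideanSpace ℝ (Fin 4)}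
    {f₁ : EuclideanSpace ℝ (Fin 2) → EuclideanSpace ℝ (Fin 4)}
    {V : EuclideanSpace ℝ (Fin 4) → EuclideanSpace ℝ (Fin 4)} {Φ : ℝ × EuclideanSpace ℝ (Fin 4) → EuclideanSpace ℝ (Fin 4)}
    {R δ' : ℝ} (hK : IsModelKnot k K₁) (hf : IsModelSliceDisc k K₁ f₁)
    (hneat : ∀ t : sphere (0 : EuclideanSpace ℝ (Fin 2)) 1,
      deriv (fun ρ : ℝ => levelFun k (f₁ (ρ • (t : EuclideanSpace ℝ (Fin 2))))) 1 < 0)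
    (hV : ContDiff ℝ ∞ V) (hVR : ∀ y, R ≤ ‖y‖ → V y = 0) (hδ' : 0 < δ')
    (htan : ∀ (u : sphere (0 : EuclideanSpace ℝ (Fin 2)) 1) (t : ℝ), 1 - δ' < t → t < 1 + δ' →
      V (f₁ (t • (u : EuclideanSpace ℝ (Fin 2)))) =
        (fderiv ℝ (fun y => levelFun k (f₁ y)) (t • (u : EuclideanSpace ℝ (Fin 2))) (u : EuclideanSpace ℝ (Fin 2)))⁻¹ •
          fderiv ℝ f₁ (t • (u : EuclideanSpace ℝ (Fin 2))) (u : EuclideanSpace ℝ (Fin 2)))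
    (hΦ : ∀ x s, HasDerivAt (fun s : ℝ => Φ (s, x)) (V (Φ (s, x))) s) (hΦ0 : ∀ x, Φ (0, x) = x) :
    ∃ ε₁ : ℝ, 0 < ε₁ ∧
      (∀ (u : sphere (0 : EuclideanSpace ℝ (Fin 2)) 1) (s : ℝ), 0 ≤ s → s < ε₁ →
        Φ (s, K₁ u) ∈ f₁ '' closedBall (0 : EuclideanSpace ℝ (Fin 2)) 1) ∧
      (∀ x ∈ closedBall (0 : EuclideanSpace ℝ (Fin 2)) 1, (∀ j, (1 : ℝ) / 2 < holeTerm k j (f₁ x)) →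
        levelFun k (f₁ x) < 1 + ε₁ →
          ∃ (u : sphere (0 : EuclideanSpace ℝ (Fin 2)) 1) (s : ℝ), 0 ≤ s ∧ s < ε₁ ∧ x = ‖x‖ • (u : EuclideanSpace ℝ (Fin 2)) ∧
            s = levelFun k (f₁ x) - 1 ∧ f₁ x = Φ (s, K₁ u)) := by
  -- the zone where the level strictly decreases along rays, and the flow lines there
  obtain ⟨δ₂, hδ₂, hδ₂h, hhole, hanti⟩ := strictAntiOn_level_ray k hK hf hneat
  set δ₃ : ℝ := min δ' δ₂ with hδ₃
  have hδ₃pos : 0 < δ₃ := lt_min hδ' hδ₂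
  have htan' : ∀ (u : sphere (0 : EuclideanSpace ℝ (Fin 2)) 1) (t : ℝ), 1 - δ₃ < t → t < 1 + δ₃ →
      V (f₁ (t • (u : EuclideanSpace ℝ (Fin 2)))) =
        (fderiv ℝ (fun y => levelFun k (f₁ y)) (t • (u : EuclideanSpace ℝ (Fin 2))) (u : EuclideanSpace ℝ (Fin 2)))⁻¹ •
          fderiv ℝ f₁ (t • (u : EuclideanSpace ℝ (Fin 2))) (u : EuclideanSpace ℝ (Fin 2)) :=
    fun u t h1 h2 => htan u t (by linarith [min_le_left δ' δ₂]) (by linarith [min_le_left δ' δ₂])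
  obtain ⟨δ'', hδ'', hlines⟩ := flow_eq_disc_ray_neat k hK hf hneat hV hVR hδ₃pos htan' hΦ hΦ0
  -- the deep disc misses the thin bands
  obtain ⟨ε₀, hε₀, hdeep⟩ := exists_bandDisc hf hδ₂
  have hone : ∀ u : sphere (0 : EuclideanSpace ℝ (Fin 2)) 1, levelFun k (f₁ ((1 : ℝ) • (u : EuclideanSpace ℝ (Fin 2)))) = 1 := by
    intro u; rw [one_smul, hf.apply_sphere u]; exact (hK.mem u).2
  have h1mem : (1 : ℝ) ∈ Ioo (1 - δ₂) (1 + δ₂) := ⟨by linarith, by linarith⟩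
  refine ⟨min δ'' ε₀, lt_min hδ'' hε₀, fun u s hs0 hs => ?_, fun x hx hh hG => ?_⟩
  · -- flow lines run into the disc
    obtain ⟨r, hr, hΦr, hGr⟩ := hlines u s (by rw [abs_of_nonneg hs0]; exact lt_of_lt_of_le hs (min_le_left _ _))
    have hr' : r ∈ Ioo (1 - δ₂) (1 + δ₂) := by
      have := abs_lt.1 hr
      exact ⟨by linarith [this.1, min_le_right δ' δ₂], by linarith [this.2, min_le_right δ' δ₂]⟩
    have hr1 : r ≤ 1 := by
      by_contra h
      push Not at h
      have := hanti u h1mem hr' h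
      simp only at this
      rw [hone u] at this
      linarith
    have hr0 : 0 < r := by linarith [hr'.1]
    rw [← hf.apply_sphere u, hΦr]
    refine ⟨r • (u : EuclideanSpace ℝ (Fin 2)), mem_closedBall_zero_iff.2 ?_, rfl⟩
    rw [norm_smul, norm_eq_of_mem_sphere, mul_one, Real.norm_eq_abs, abs_of_pos hr0]
    exact hr1
  · -- points of the disc in the thin band are on flow lines
    have hxn : 1 - δ₂ < ‖x‖ := hdeep x hx hh (lt_of_lt_of_le hG (by linarith [min_le_right δ'' ε₀]))
    have hx1 : ‖x‖ ≤ 1 := mem_closedBall_zero_iff.1 hx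
    have hx0 : 0 < ‖x‖ := by linarith
    have hxne : x ≠ 0 := norm_pos_iff.1 hx0
    have hu : ‖x‖⁻¹ • x ∈ sphere (0 : EuclideanSpace ℝ (Fin 2)) 1 := by
      simp [norm_smul, inv_mul_cancel₀ hx0.ne']
    set u : sphere (0 : EuclideanSpace ℝ (Fin 2)) 1 := ⟨_, hu⟩ with hudef
    have hxu : x = ‖x‖ • (u : EuclideanSpace ℝ (Fin 2)) := by
      simp only [hudef, smul_smul, mul_inv_cancel₀ hx0.ne', one_smul]
    have htmem : ‖x‖ ∈ Ioo (1 - δ₂) (1 + δ₂) := ⟨hxn, by linarith⟩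
    set s : ℝ := levelFun k (f₁ x) - 1 with hsdef
    have hs0 : 0 ≤ s := by
      rcases hx1.lt_or_eq with hlt | heq
      · have := hanti u htmem h1mem hlt
        simp only at this
        rw [hone u, ← hxu] at this
        linarith
      · rw [hsdef, hxu, heq, hone u]; simp
    have hs1 : s < min δ'' ε₀ := by rw [hsdef]; linarith
    obtain ⟨r, hr, hΦr, hGr⟩ := hlines u s (by rw [abs_of_nonneg hs0]; exact lt_of_lt_of_le hs1 (min_le_left _ _))
    have hr' : r ∈ Ioo (1 - δ₂) (1 + δ₂) := by
      have := abs_lt.1 hr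
      exact ⟨by linarith [this.1, min_le_right δ' δ₂], by linarith [this.2, min_le_right δ' δ₂]⟩
    have hrt : r = ‖x‖ := by
      have hGt : levelFun k (f₁ (‖x‖ • (u : EuclideanSpace ℝ (Fin 2)))) = 1 + s := by rw [← hxu, hsdef]; ring
      exact (hanti u).injOn hr' htmem (show levelFun k (f₁ (r • (u : EuclideanSpace ℝ (Fin 2)))) = levelFun k (f₁ (‖x‖ • (u : EuclideanSpace ℝ (Fin 2)))) by rw [hGr, hGt])
    refine ⟨u, s, hs0, hs1, hxu, rfl, ?_⟩
    rw [← hf.apply_sphere u, hΦr, hrt, ← hxu]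

end FriendsCarrierVk

open FriendsCarrierVk in
/-- **Helper `helper_friendsCarrier_Vk_discBand`** (registered piece of `helper_friendsCarrier_Vk`: the slice
disc meets the collar band exactly in the flow lines from `K₁`).  For the neat-adapted field `V` of a neat
model slice disc `f₁` (tangency `V(f₁(t u)) = (d(G_k ∘ f₁)(t u) u)⁻¹ • df₁(t u) u` for `|t - 1| < δ'`) and
any flow `Φ` of `V`, there is `ε₁ > 0` such that `Φ(s, K₁ u) ∈ f₁(𝔻²)` for `0 ≤ s < ε₁`, and every
`f₁ x` (`‖x‖ ≤ 1`) off the poles with `G_k(f₁ x) < 1 + ε₁` is `Φ(s, K₁ u)` with `u = x/‖x‖`, `s = G_k(f₁ x) - 1 ∈ [0, ε₁)`. [folklore] -/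
theorem helper_friendsCarrier_Vk_discBand : ∀ (k : ℕ) (K₁ : (Metric.sphere (0 : EuclideanSpace ℝ (Fin 2)) 1) → EuclideanSpace ℝ (Fin 4)) (f₁ : EuclideanSpace ℝ (Fin 2) → EuclideanSpace ℝ (Fin 4)) (V : EuclideanSpace ℝ (Fin 4) → EuclideanSpace ℝ (Fin 4)) (Φ : ℝ × EuclideanSpace ℝ (Fin 4) → EuclideanSpace ℝ (Fin 4)) (R δ' : ℝ), Literature.Topology.FourManifolds.MMSW.IsModelKnot k K₁ → Literature.Topology.FourManifolds.MMSW.IsModelSliceDisc k K₁ f₁ → (∀ t : (Metric.sphere (0 : EuclideanSpace ℝ (Fin 2)) 1), deriv (fun ρ : ℝ => Literature.Topology.FourManifolds.MMSW.levelFun k (f₁ (ρ • (t : EuclideanSpace ℝ (Fin 2))))) 1 < 0) → ContDiff ℝ ((⊤ : ℕ∞) : WithTop ℕ∞) V → (∀ y, R ≤ ‖y‖ → V y = 0) → 0 < δ' → (∀ (u : (Metric.sphere (0 : EuclideanSpace ℝ (Fin 2)) 1)) (t : ℝ), 1 - δ' < t → t < 1 + δ' → V (f₁ (t • (u : EuclideanSpace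 ℝ (Fin 2)))) = (fderiv ℝ (fun y => Literature.Topology.FourManifolds.MMSW.levelFun k (f₁ y)) (t • (u : EuclideanSpace ℝ (Fin 2))) (u : EuclideanSpace ℝ (Fin 2)))⁻¹ • fderiv ℝ f₁ (t • (u : EuclideanSpace ℝ (Fin 2))) (u : EuclideanSpace ℝ (Fin 2))) → (∀ x s, HasDerivAt (fun s : ℝ => Φ (s, x)) (V (Φ (s, x))) s) → (∀ x, Φ (0, x) = x) → ∃ ε₁ : ℝ, 0 < ε₁ ∧ (∀ (u : (Metric.sphere (0 : EuclideanSpace ℝ (Fin 2)) 1)) (s : ℝ), 0 ≤ s → s < ε₁ → Φ (s, K₁ u) ∈ f₁ '' Metric.closedBall (0 : EuclideanSpace ℝ (Fin 2)) 1) ∧ (∀ x ∈ Metric.closedBall (0 : EuclideanSpace ℝ (Fin 2)) 1, (∀ j, (1 : ℝ) / 2 < Literature.Topology.FourManifolds.MMSW.holeTerm k j (f₁ x)) → Literature.Topology.FourManifolds.MMSW.levelFun k (f₁ x) < 1 + ε₁ → ∃ (u : (Metric.sphere (0 : EuclideanSpace ℝ (Fin 2)) 1)) (s : ℝ), 0 ≤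 s ∧ s < ε₁ ∧ x = ‖x‖ • (u : EuclideanSpace ℝ (Fin 2)) ∧ s = Literature.Topology.FourManifolds.MMSW.levelFun k (f₁ x) - 1 ∧ f₁ x = Φ (s, K₁ u)) :=
  fun k _ _ _ _ _ _ hK hf hneat hV hVR hδ' htan hΦ hΦ0 => discBand k hK hf hneat hV hVR hδ' htan hΦ hΦ0

end Summit.SmoothPoincare4.SmoothPoincare4.Theorems.DcrGap.MkFriends

end
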